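import Mathlib
import Summits.Ventures.HodgeRepro.Tier4.Line1.RTFSetting

/-!
# Tier4/Line1/OrbitalPhase — LINE L1, J2.c′ rung (c′.1): phase control near an adelically regular element

Blind re-derivation cell `pub-hodge-repro`, Tier 4 «prove the step» (README §9–§10), seat t4-L1-p2 (prover, gen 0),
LINE L1 (t4-plan-1), assignment S12232 (J2.c′), rungs S12304.  This module: two measure helpers
(`exists_pos_measure_smul_mem`, `exists_subset_fd_pos_measure`: from `ae_covers` of a fundamental domain for a
COUNTABLE group, a set of positive measure meets some translate of the domain in positive measure — the ONLY place
where `[Countable Gk]` enters the line's analytic half); (c′.1) `exists_open_phase_re_pos` — for compact `K ⊆ T`,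
`K' ⊆ T'`, an adelically regular rational `γ₀` (stabiliser in `T × T'` = the diagonal centre, `hreg`), characters
with `CentralMatch` and unitarity, there is an open `V ∋ γ₀` inside a given open `U` such that
`Re(χ(c) conj χ'(c')) > 1/2` whenever `c ∈ K`, `c' ∈ K'`, `c⁻¹ γ₀ c' ∈ V`: the set `F = {(c, c') ∈ K × K' :
Re phase ≤ 1/2}` is compact, its image under the orbit map is compact hence CLOSED (`T2Space G`) and misses `γ₀`
(a point of the fibre over `γ₀` is `(z, z)` with `z ∈ Z` by `hreg`, where the phase is `χ(z) conj χ'(z) = |χ(z)|² = 1`);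
`exists_nhds_orbit_mem` — open neighbourhoods of `1` in `T`, `T'` mapped by the orbit map into a given open `W ∋ γ₀`.
NO Tietze extension and NO quotient-map descent are needed: (c′.2) works with the phase itself.
Imports Mathlib + `RTFSetting` (p662473) only.

Nothing here says anything about the status of the Hodge conjecture for CM abelian varieties, which is NOT proved
(HC_CM is NOT proved by anyone in this repository).
-/

set_option autoImplicit false

noncomputable section

/-! ## OrbitalPhase — measure helpers (`ae_covers` for a countable group), (c′.1) phase control near an adelically
regular element, neighbourhoods of `1` mapped into a neighbourhood of `γ₀` by the orbit map (t4-L1-p2, for J2.c′) -/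

namespace Summit.Ventures.HodgeRepro.Tier4.Line1.RTF

open MeasureTheory Topology Filter Set
open scoped Pointwise

section MeasureHelper

variable {H : Type} [Group H] [MeasurableSpace H]

/-- from `ae_covers` of a fundamental domain for a COUNTABLE group: a set of positive measure meets some
translate `{x | g • x ∈ D}` in positive measure. -/
theorem exists_pos_measure_smul_mem {Γ : Subgroup H} [Countable Γ] {μ : Measure H} {D : Set H}
    (hD : IsFundamentalDomain Γ D μ) {N : Set H} (hN : 0 < μ N) :
    ∃ g : Γ, 0 < μ (N ∩ {x | g • x ∈ D}) := by
  by_contra hcon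
  simp only [not_exists, not_lt] at hcon
  have hzero : ∀ g : Γ, μ (N ∩ {x | g • x ∈ D}) = 0 := fun g => le_antisymm (hcon g) zero_le
  have hbad : μ {x | ¬ ∃ g : Γ, g • x ∈ D} = 0 := by
    have := hD.ae_covers
    rwa [ae_iff] at this
  have hsplit : N ⊆ (⋃ g : Γ, N ∩ {x | g • x ∈ D}) ∪ {x | ¬ ∃ g : Γ, g • x ∈ D} := by
    intro x hx
    by_cases h : ∃ g : Γ, g • x ∈ D
    · obtain ⟨g, hg⟩ := h
      exact Or.inl (mem_iUnion.2 ⟨g, hx, hg⟩)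
    · exact Or.inr h
  have : μ N ≤ 0 := by
    calc μ N ≤ μ ((⋃ g : Γ, N ∩ {x | g • x ∈ D}) ∪ {x | ¬ ∃ g : Γ, g • x ∈ D}) := measure_mono hsplit
      _ ≤ μ (⋃ g : Γ, N ∩ {x | g • x ∈ D}) + μ {x | ¬ ∃ g : Γ, g • x ∈ D} := measure_union_le _ _
      _ ≤ (∑' g : Γ, μ (N ∩ {x | g • x ∈ D})) + 0 := by
          gcongr
          · exact measure_iUnion_le _
          · exact hbad.le
      _ = 0 := by simp [hzero]
  exact absurd hN (not_lt.2 this)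

/-- a positive-measure piece of a fundamental domain, for a COUNTABLE group and a left-invariant open-positive
measure: some translate `g⁻¹ · N₁` of a subset `N₁ ⊆ D` of positive measure lies in a given open `N ∋ 1`. -/
theorem exists_subset_fd_pos_measure {H : Type} [Group H] [TopologicalSpace H] [IsTopologicalGroup H]
    [MeasurableSpace H] [BorelSpace H] {μ : Measure H} [μ.IsMulLeftInvariant] [μ.IsOpenPosMeasure]
    {Γ : Subgroup H} [Countable Γ] {D : Set H} (hD : IsFundamentalDomain Γ D μ) {N : Set H}
    (hN : IsOpen N) (h1 : (1 : H) ∈ N) :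
    ∃ g : Γ, ∃ N₁ : Set H, N₁ ⊆ D ∧ 0 < μ N₁ ∧ ∀ t ∈ N₁, (g : H)⁻¹ * t ∈ N := by
  obtain ⟨g, hg⟩ := exists_pos_measure_smul_mem hD (hN.measure_pos μ ⟨1, h1⟩)
  refine ⟨g, D ∩ (fun y => (g : H)⁻¹ * y) ⁻¹' N, inter_subset_left, ?_, fun t ht => ht.2⟩
  have hpre : (fun h => (g : H) * h) ⁻¹' (D ∩ (fun y => (g : H)⁻¹ * y) ⁻¹' N) =
      N ∩ {x | g • x ∈ D} := by
    ext x
    simp only [Set.mem_preimage, Set.mem_inter_iff, Set.mem_setOf_eq, inv_mul_cancel_left,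
      Subgroup.smul_def]
    exact and_comm
  rw [← measure_preimage_mul μ (g : H), hpre]
  exact hg

end MeasureHelper

variable {G : Type} [Group G] [TopologicalSpace G] [IsTopologicalGroup G] [MeasurableSpace G]
  [BorelSpace G]

namespace Setting

variable (S : Setting G)

omit [BorelSpace G] in
/-- (c′.1, M) PHASE CONTROL near an adelically regular `γ₀`: on compact `K ⊆ T`, `K' ⊆ T'` the phase
`χ(c) conj χ'(c')` is `1` on the fibre of the orbit map over `γ₀` (the fibre is the diagonal centre by `hreg`,
where `CentralMatch` + unitarity give `1`), so it has real part `> 1/2` wherever `c⁻¹ γ₀ c'` lies in a small open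
`V ∋ γ₀` (the image of the compact set `{phase.re ≤ 1/2}` is closed and misses `γ₀`). -/
theorem exists_open_phase_re_pos [T2Space G] {χ : S.T → ℂ} {χ' : S.T' → ℂ} (hχ : S.IsCharacter χ)
    (hχ' : S.IsCharacter' χ') (hZ : S.CentralMatch χ χ') (γ₀ : S.Gk)
    (hreg : ∀ t ∈ S.T, ∀ t' ∈ S.T', t⁻¹ * γ₀ * t' = γ₀ → t ∈ S.Z ∧ t' = t)
    {K : Set S.T} (hK : IsCompact K) {K' : Set S.T'} (hK' : IsCompact K') {U : Set G} (hU : IsOpen U)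
    (hγ : (γ₀ : G) ∈ U) :
    ∃ V : Set G, IsOpen V ∧ (γ₀ : G) ∈ V ∧ V ⊆ U ∧
      ∀ c ∈ K, ∀ c' ∈ K', (c : G)⁻¹ * γ₀ * c' ∈ V → 1 / 2 < (χ c * starRingEnd ℂ (χ' c')).re := by
  -- the orbit map and the bad set
  have hmc : Continuous fun p : S.T × S.T' => (p.1 : G)⁻¹ * γ₀ * p.2 :=
    ((continuous_subtype_val.comp continuous_fst).inv.mul continuous_const).mul
      (continuous_subtype_val.comp continuous_snd)
  have hphc : Continuous fun p : S.T × S.T' => (χ p.1 * starRingEnd ℂ (χ' p.2)).re :=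
    Complex.continuous_re.comp ((hχ.cont.comp continuous_fst).mul
      ((continuous_star : Continuous (starRingEnd ℂ)).comp (hχ'.cont.comp continuous_snd)))
  have hFc : IsCompact ((K ×ˢ K') ∩ {p : S.T × S.T' | (χ p.1 * starRingEnd ℂ (χ' p.2)).re ≤ 1 / 2}) :=
    (hK.prod hK').inter_right (isClosed_le hphc continuous_const)
  have himc : IsClosed ((fun p : S.T × S.T' => (p.1 : G)⁻¹ * γ₀ * p.2) ''
      ((K ×ˢ K') ∩ {p : S.T × S.T' | (χ p.1 * starRingEnd ℂ (χ' p.2)).re ≤ 1 / 2})) :=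
    (hFc.image hmc).isClosed
  have hγnot : (γ₀ : G) ∉ (fun p : S.T × S.T' => (p.1 : G)⁻¹ * γ₀ * p.2) ''
      ((K ×ˢ K') ∩ {p : S.T × S.T' | (χ p.1 * starRingEnd ℂ (χ' p.2)).re ≤ 1 / 2}) := by
    rintro ⟨⟨c, c'⟩, ⟨-, hle⟩, heq⟩
    obtain ⟨hcZ, hcc'⟩ := hreg (c : G) c.2 (c' : G) c'.2 heq
    have hχc : χ c = χ' c' := by
      have h1 := hZ (c : G) hcZ
      have e1 : (⟨(c : G), S.ZleT hcZ⟩ : S.T) = c := Subtype.ext rfl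
      have e2 : (⟨(c : G), S.ZleT' hcZ⟩ : S.T') = c' := Subtype.ext hcc'.symm
      rw [e1, e2] at h1
      exact h1
    simp only [Set.mem_setOf_eq] at hle
    rw [← hχc, Complex.mul_conj, Complex.ofReal_re, Complex.normSq_eq_norm_sq, hχ.unit] at hle
    norm_num at hle
  refine ⟨U ∩ ((fun p : S.T × S.T' => (p.1 : G)⁻¹ * γ₀ * p.2) ''
      ((K ×ˢ K') ∩ {p : S.T × S.T' | (χ p.1 * starRingEnd ℂ (χ' p.2)).re ≤ 1 / 2}))ᶜ,
    hU.inter himc.isOpen_compl, ⟨hγ, hγnot⟩, inter_subset_left, ?_⟩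
  intro c hc c' hc' hmem
  by_contra hle
  apply hmem.2
  exact ⟨(c, c'), ⟨⟨hc, hc'⟩, not_lt.1 hle⟩, rfl⟩

omit [BorelSpace G] in
/-- open neighbourhoods of `1` in `T` and `T'` whose orbit-map image lies in a given open `W ∋ γ₀` -/
theorem exists_nhds_orbit_mem (γ₀ : S.Gk) {W : Set G} (hW : IsOpen W) (hγ : (γ₀ : G) ∈ W) :
    ∃ N : Set S.T, IsOpen N ∧ (1 : S.T) ∈ N ∧ ∃ N' : Set S.T', IsOpen N' ∧ (1 : S.T') ∈ N' ∧
      ∀ c ∈ N, ∀ c' ∈ N', (c : G)⁻¹ * γ₀ * c' ∈ W := by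
  have hmc : Continuous fun p : S.T × S.T' => (p.1 : G)⁻¹ * γ₀ * p.2 :=
    ((continuous_subtype_val.comp continuous_fst).inv.mul continuous_const).mul
      (continuous_subtype_val.comp continuous_snd)
  have hpre : (fun p : S.T × S.T' => (p.1 : G)⁻¹ * γ₀ * p.2) ⁻¹' W ∈ 𝓝 ((1 : S.T), (1 : S.T')) := by
    apply hmc.continuousAt.preimage_mem_nhds
    rw [hW.mem_nhds_iff]
    simpa using hγ
  obtain ⟨N, N', hNo, h1N, hN'o, h1N', hsub⟩ := mem_nhds_prod_iff'.1 hpre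
  exact ⟨N, hNo, h1N, N', hN'o, h1N', fun c hc c' hc' => hsub (Set.mk_mem_prod hc hc')⟩

end Setting

end Summit.Ventures.HodgeRepro.Tier4.Line1.RTF

end
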